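import Summits.CriticalPhenomena.Ising3DConformalLimit.Theses.PrecisionLaplacian
import Summits.CriticalPhenomena.Ising3DConformalLimit.Theses.BernsteinTemperature
import Summits.CriticalPhenomena.Ising3DConformalLimit.Theses.PerfectScreening
import Summits.CriticalPhenomena.Ising3DConformalLimit.Theses.IsingEuclidUpgrade
import HarnessLib

/-!
# Crux `MoebiusLimitOfTwoPointLaw` (item stmt-CriticalPhenomena-4801) is the implication item 0634 → item 1344

The crux of routes PrecisionLaplacian / BernsteinTemperature reads, character for character,
`IsingEuclidUpgrade.IsingEuclidUpgradeR2RotInvPowerLaw → PerfectScreening.MoebiusLimitExists`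
(item stmt-CriticalPhenomena-0634 → item stmt-CriticalPhenomena-1344). This file records that
reading as kernel facts (`Iff.rfl`) and the resulting dependency edge: a proof of item 1344 closes
the crux outright (the two-point-law hypothesis is then idle). Together with
`PrecisionLaplacianMoebiusLimitOfTwoPointLawBareFactorisation` (crux ↔ (0634 → 4738 ∧ 8367 ∧ 1982))
these are the two machine-visible ways the crux can close from neighbouring items.
-/

namespace Summit.CriticalPhenomena.Ising3DConformalLimit.PrecisionLaplacianMoebiusLimitOfTwoPointLaw

open Summit.CriticalPhenomena.Ising3DConformalLimit.Theses

/-- **The crux is literally `0634 → 1344`.** `PrecisionLaplacian.MoebiusLimitOfTwoPointLaw` unfolds, by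
`Iff.rfl`, to `IsingEuclidUpgradeR2RotInvPowerLaw → MoebiusLimitExists`. -/
theorem moebiusLimitOfTwoPointLaw_iff_moebiusLimitExists_of_twoPointLaw :
    PrecisionLaplacian.MoebiusLimitOfTwoPointLaw ↔
      (IsingEuclidUpgrade.IsingEuclidUpgradeR2RotInvPowerLaw → PerfectScreening.MoebiusLimitExists) :=
  Iff.rfl

/-- The same reading for the second host route's spelling
(`BernsteinTemperature.MoebiusLimitOfTwoPointLaw`, identical definiens). -/
theorem moebiusLimitOfTwoPointLaw'_iff_moebiusLimitExists_of_twoPointLaw :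
    BernsteinTemperature.MoebiusLimitOfTwoPointLaw ↔
      (IsingEuclidUpgrade.IsingEuclidUpgradeR2RotInvPowerLaw → PerfectScreening.MoebiusLimitExists) :=
  Iff.rfl

/-- **Item 1344 closes the crux.** If the critical correlators of the Ising model on `ℤ³` have a
non-degenerate Möbius-covariant pointwise scaling limit (`PerfectScreening.MoebiusLimitExists`,
item stmt-CriticalPhenomena-1344), then `PrecisionLaplacian.MoebiusLimitOfTwoPointLaw` holds (its
two-point-law hypothesis is not used). -/
theorem moebiusLimitOfTwoPointLaw_of_moebiusLimitExists :
    PerfectScreening.MoebiusLimitExists → PrecisionLaplacian.MoebiusLimitOfTwoPointLaw :=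
  fun h => moebiusLimitOfTwoPointLaw_iff_moebiusLimitExists_of_twoPointLaw.mpr fun _ => h

/-- Item 1344 closes the crux, second host route's spelling
(`BernsteinTemperature.MoebiusLimitOfTwoPointLaw`). -/
theorem moebiusLimitOfTwoPointLaw_of_moebiusLimitExists' :
    PerfectScreening.MoebiusLimitExists → BernsteinTemperature.MoebiusLimitOfTwoPointLaw :=
  fun h => moebiusLimitOfTwoPointLaw'_iff_moebiusLimitExists_of_twoPointLaw.mpr fun _ => h

/-- **Conversely, under item 0634 the crux gives item 1344 back** (modus ponens), so given the
two-point law the crux and item 1344 are equivalent. -/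
theorem moebiusLimitExists_of_moebiusLimitOfTwoPointLaw
    (h : PrecisionLaplacian.MoebiusLimitOfTwoPointLaw)
    (hP : IsingEuclidUpgrade.IsingEuclidUpgradeR2RotInvPowerLaw) :
    PerfectScreening.MoebiusLimitExists :=
  h hP

end Summit.CriticalPhenomena.Ising3DConformalLimit.PrecisionLaplacianMoebiusLimitOfTwoPointLaw
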